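import Summits.QuantumAdvantage.AdviceFreeQNC0.CodegOne
import Summits.QuantumAdvantage.QuantumAdvantage.Theorems.MobiusLadderDigitPolyUniformityLAROrthLeLowDeg
import Literature.LinearAlgebra.MeshulamBoundedRank
import HarnessLib

/-!
# Cell qa-qnc0 (rung F-S1, route RingFrame, crux α, line `tensor`): R1U at co-degree two, part 1 —
# the order-`≤ 2` syndrome of `RM(m−3, m)`, moment matrices, and Meshulam's bound

Planner qa-qnc0-p2's ROUND-5 THEOREM E2 (`LiftOneUCodegTwo : LiftOneUAt 3 2`) bounds the transversal
number of a LIGHT row system modulo `RM(d, d+3)`.  This file supplies the invariants: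

* `Syndrome2.syn2` — the order-`≤ 2` syndrome `g ↦ (Σ_v g(v)·x_J(v))_{|J| ≤ 2}` on `𝔽₂^{{0,1}^m}`
  (zero on the coordinates `|J| > 2`); **`ker syn2 = RM(d, d+3)`** (`ker_syn2_eq_lowDeg`): `⊇` by the
  even-weight lemma `sum_univ_eq_zero_of_mem_lowDeg`, `⊆` by Reed–Muller duality
  (`SketchLAR.stub_orth_le_lowDeg`, `RM(2)^⊥ ⊆ RM(m−3)`).
* `Syndrome2.momMat` — the MOMENT MATRIX `s ↦ (s_{{i,j}})_{i,j}` (diagonal = point sums, off-diagonal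
  = pair sums), linear in the syndrome; for the indicator of a point set `a`,
  `momMat (syn2 𝟙_a) = Σ_{v ∈ a} v vᵀ` (`momMat_syn2_indF`).
* `Syndrome2.rank_momMat_le_two` — **a set of `≤ 4` points of even size and zero point-sum has moment
  matrix of rank `≤ 2`**: it is empty or a zero-sum quadruple `{p, q, r, p+q+r}` (an affine `2`-flat),
  and then `Σ v vᵀ = x yᵀ + y xᵀ` with `x = p + q`, `y = p + r`; a pair `{p, q}` with `p + q = 0` is
  impossible (`eq_empty_of_card_le_three`: size `≤ 3` forces `a = ∅`).
* `Syndrome2.finrank_le_two_mul` — **Meshulam**: a space of syndromes with zero parity, vanishing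
  beyond order `2`, all of whose moment matrices have rank `≤ 2`, has dimension `≤ 2m` (the moment
  matrix is injective on it; `Literature.LinearAlgebra.Meshulam1985_exists_rank_gt_holds`, the
  tree's PROVED Meshulam 1985 Thm 2: `dim W > r·n ⇒ W ∋ A, rank A > r`).

Part 2 (`CodegTwo.lean`) assembles the lift.  The cell's lemmas (planner qa-qnc0-p2 gen 5 ROUND-5 §2,
quadratic layer via Meshulam instead of the star/top dichotomy; prover qa-qnc0-prover gen 6,
2026-08-27).  WHAT THIS IS NOT: no transversal bound sharper than `4·dim` (the `(d+3)f/4` STAR bound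
of ROUND-5 needs the clique/star/top argument, not done here); nothing on co-degree `≥ 3`, `LiftOneU`,
α or the separation.

## References

* R. Meshulam, *On the maximal rank in a subspace of matrices*, Quart. J. Math. Oxford 36 (1985)
  225–229, Thm 2 [Meshulam1985] (through `Meshulam1985_exists_rank_gt_holds`).
-/

noncomputable section

namespace Summit.QuantumAdvantage.AdviceFreeQNC0

open Finset Module
open Literature.Computability.MetaComplexity Literature.Computability.MetaComplexity.Smolensky

namespace Syndrome2

variable {m : ℕ}

/-! ### The order-`≤ 2` syndrome -/

/-- **The order-`≤ 2` syndrome**: `syn2 g J = Σ_v g(v)·x_J(v)` for `|J| ≤ 2`, and `0` for `|J| > 2`. -/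
def syn2 : CubeFn (ZMod 2) m →ₗ[ZMod 2] (Finset (Fin m) → ZMod 2) where
  toFun g J := if J.card ≤ 2 then ∑ v, g v * mono (ZMod 2) J v else 0
  map_add' g h := by
    funext J
    simp only [Pi.add_apply]
    split_ifs with hJ
    · rw [← Finset.sum_add_distrib]
      exact Finset.sum_congr rfl fun v _ => by ring
    · rw [add_zero]
  map_smul' c g := by
    funext J
    simp only [Pi.smul_apply, smul_eq_mul, RingHom.id_apply]
    split_ifs with hJ
    · rw [Finset.mul_sum]
      exact Finset.sum_congr rfl fun v _ => by ring
    · rw [mul_zero]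

/-- Unfolding lemma. -/
theorem syn2_apply (g : CubeFn (ZMod 2) m) (J : Finset (Fin m)) :
    syn2 g J = if J.card ≤ 2 then ∑ v, g v * mono (ZMod 2) J v else 0 := rfl

/-- On a small index set the syndrome is the pairing with the monomial. -/
theorem syn2_apply_of_le (g : CubeFn (ZMod 2) m) {J : Finset (Fin m)} (hJ : J.card ≤ 2) :
    syn2 g J = ∑ v, g v * mono (ZMod 2) J v := by
  rw [syn2_apply, if_pos hJ]

/-- The syndrome vanishes beyond order `2`. -/
theorem syn2_apply_of_gt (g : CubeFn (ZMod 2) m) {J : Finset (Fin m)} (hJ : ¬ J.card ≤ 2) :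
    syn2 g J = 0 := by
  rw [syn2_apply, if_neg hJ]

/-- `RM(d, d+3) ≤ ker syn2`: a degree-`≤ d` function times a monomial of degree `≤ 2` has degree
`≤ d + 2 < d + 3`, hence even weight. -/
theorem lowDeg_le_ker_syn2 (d : ℕ) :
    lowDeg (ZMod 2) (d + 3) d ≤ LinearMap.ker (syn2 (m := d + 3)) := by
  intro g hg
  rw [LinearMap.mem_ker]
  funext J
  rw [Pi.zero_apply, syn2_apply]
  split_ifs with hJ
  · have hmem : (g * mono (ZMod 2) J) ∈ lowDeg (ZMod 2) (d + 3) (d + 2) :=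
      mul_mem_lowDeg_add hg (mono_mem_lowDeg hJ)
    have h := sum_univ_eq_zero_of_mem_lowDeg hmem (by omega)
    simpa only [Pi.mul_apply] using h
  · rfl

/-- `ker syn2 ≤ RM(d, d+3)`: a function orthogonal to all monomials of degree `≤ 2` is orthogonal to
`RM(2, d+3)`, hence (Reed–Muller duality, `stub_orth_le_lowDeg`) of degree `≤ d`. -/
theorem ker_syn2_le_lowDeg (d : ℕ) :
    LinearMap.ker (syn2 (m := d + 3)) ≤ lowDeg (ZMod 2) (d + 3) d := by
  intro g hg
  rw [LinearMap.mem_ker] at hg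
  refine Summit.QuantumAdvantage.DigitPolyUniformity.SketchLAR.stub_orth_le_lowDeg (k := 2)
    (by omega) g fun f hf => ?_
  rw [lowDeg_eq_span] at hf
  induction hf using Submodule.span_induction with
  | mem f hf =>
    obtain ⟨⟨J, hJ⟩, rfl⟩ := hf
    have h := congrFun hg J
    rw [Pi.zero_apply, syn2_apply_of_le g hJ] at h
    exact h
  | zero => simp
  | add f f' _ _ hf hf' =>
    simp only [Pi.add_apply, mul_add, Finset.sum_add_distrib, hf, hf', add_zero]
  | smul c f _ hf =>
    simp only [Pi.smul_apply, smul_eq_mul]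
    calc ∑ b, g b * (c * f b) = c * ∑ b, g b * f b := by
          rw [Finset.mul_sum]; exact Finset.sum_congr rfl fun b _ => by ring
      _ = 0 := by rw [hf, mul_zero]

/-- **`ker syn2 = RM(d, d+3)`.** -/
theorem ker_syn2_eq_lowDeg (d : ℕ) :
    LinearMap.ker (syn2 (m := d + 3)) = lowDeg (ZMod 2) (d + 3) d :=
  le_antisymm (ker_syn2_le_lowDeg d) (lowDeg_le_ker_syn2 d)

/-! ### Indicators, points as vectors, the moment matrix -/

/-- the point `v ∈ {0,1}^m` as a vector of `𝔽₂^m`. -/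
def bvec (v : Fin m → Bool) : Fin m → ZMod 2 := fun i => if v i = true then 1 else 0

/-- `bvec` is injective. -/
theorem bvec_injective : Function.Injective (bvec (m := m)) := by
  intro v w h
  funext i
  have hi := congrFun h i
  unfold bvec at hi
  revert hi
  cases v i <;> cases w i <;> simp

/-- the indicator of a set of points. -/
def indF (a : Finset (Fin m → Bool)) : CubeFn (ZMod 2) m := fun v => if v ∈ a then 1 else 0

/-- A monomial at a point is the product of the point's coordinates over the index set. -/
theorem mono_eq_prod_bvec (J : Finset (Fin m)) (v : Fin m → Bool) :
    mono (ZMod 2) J v = ∏ i ∈ J, bvec v i := rfl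

/-- Pairing an indicator with a function sums the function over the set. -/
theorem sum_indF_mul (a : Finset (Fin m → Bool)) (f : (Fin m → Bool) → ZMod 2) :
    ∑ v, indF a v * f v = ∑ v ∈ a, f v := by
  unfold indF
  rw [← Finset.sum_filter_add_sum_filter_not univ (fun v => v ∈ a)]
  have h1 : ∑ v ∈ univ.filter (fun v => v ∈ a), (if v ∈ a then (1 : ZMod 2) else 0) * f v = ∑ v ∈ a, f v := by
    have e : univ.filter (fun v : Fin m → Bool => v ∈ a) = a := by ext v; simp
    rw [e]
    exact Finset.sum_congr rfl fun v hv => by rw [if_pos hv, one_mul]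
  have h2 : ∑ v ∈ univ.filter (fun v => ¬ v ∈ a), (if v ∈ a then (1 : ZMod 2) else 0) * f v = 0 :=
    Finset.sum_eq_zero fun v hv => by
      rw [Finset.mem_filter] at hv
      rw [if_neg hv.2, zero_mul]
  rw [h1, h2, add_zero]

/-- **The moment matrix** of a syndrome: `(momMat s)_{ij} = s_{{i,j}}` (diagonal: point sums;
off-diagonal: pair sums). -/
def momMat : (Finset (Fin m) → ZMod 2) →ₗ[ZMod 2] Matrix (Fin m) (Fin m) (ZMod 2) where
  toFun s := Matrix.of fun i j => s {i, j}
  map_add' s t := by ext i j; rfl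
  map_smul' c s := by ext i j; rfl

/-- Unfolding lemma. -/
theorem momMat_apply (s : Finset (Fin m) → ZMod 2) (i j : Fin m) : momMat s i j = s {i, j} := rfl

/-- `#{i, j} ≤ 2`. -/
theorem card_pair_le (i j : Fin m) : ({i, j} : Finset (Fin m)).card ≤ 2 :=
  (Finset.card_insert_le _ _).trans (by rw [Finset.card_singleton])

/-- **The moment matrix of a point set**: `momMat (syn2 𝟙_a) = Σ_{v ∈ a} v vᵀ`. -/
theorem momMat_syn2_indF (a : Finset (Fin m → Bool)) :
    momMat (syn2 (indF a)) = ∑ v ∈ a, Matrix.vecMulVec (bvec v) (bvec v) := by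
  ext i j
  rw [momMat_apply, syn2_apply_of_le _ (card_pair_le i j), sum_indF_mul, Matrix.sum_apply]
  refine Finset.sum_congr rfl fun v _ => ?_
  rw [Matrix.vecMulVec_apply, mono_eq_prod_bvec]
  by_cases hij : i = j
  · subst hij
    rw [Finset.insert_eq_of_mem (Finset.mem_singleton_self _), Finset.prod_singleton]
    unfold bvec
    cases v i <;> simp
  · rw [Finset.prod_pair hij]

/-- The parity coordinate of a point set: `syn2 𝟙_a ∅ = |a|`. -/
theorem syn2_indF_empty (a : Finset (Fin m → Bool)) : syn2 (indF a) ∅ = (a.card : ZMod 2) := by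
  rw [syn2_apply_of_le _ (by simp), sum_indF_mul]
  simp [mono_eq_prod_bvec]

/-- The point-sum coordinates of a point set: `syn2 𝟙_a {i} = Σ_{v ∈ a} v_i`. -/
theorem syn2_indF_singleton (a : Finset (Fin m → Bool)) (i : Fin m) :
    syn2 (indF a) {i} = ∑ v ∈ a, bvec v i := by
  rw [syn2_apply_of_le _ (by simp), sum_indF_mul]
  simp [mono_eq_prod_bvec]

/-! ### The rank of the moment matrix of a light even zero-sum set -/

/-- In `𝔽₂`, `x + y = 0 ↔ x = y`. [folklore] -/
private theorem add_eq_zero_iff_eq' (x y : ZMod 2) : x + y = 0 ↔ x = y := by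
  revert x y; decide

/-- **A set of at most three points of even size and zero point-sum is empty** (a pair `{p, q}`
with `p + q = 0` would have `p = q`). -/
theorem eq_empty_of_card_le_three (a : Finset (Fin m → Bool)) (h3 : a.card ≤ 3)
    (heven : Even a.card) (hσ : ∀ i, ∑ v ∈ a, bvec v i = 0) : a = ∅ := by
  have hc : a.card = 0 ∨ a.card = 2 := by
    obtain ⟨k, hk⟩ := heven
    omega
  rcases hc with hc | hc
  · exact Finset.card_eq_zero.1 hc
  · exfalso
    obtain ⟨p, q, hpq, rfl⟩ := Finset.card_eq_two.1 hc
    apply hpq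
    apply bvec_injective
    funext i
    have h := hσ i
    rw [Finset.sum_pair hpq, add_eq_zero_iff_eq'] at h
    exact h

/-- The quadruple identity in `𝔽₂`: with `s = p + q + r` coordinatewise,
`p pᵀ + q qᵀ + r rᵀ + s sᵀ = x yᵀ + y xᵀ`, `x = p + q`, `y = p + r`. -/
private theorem quad_entry (a b c a' b' c' : ZMod 2) :
    a * a' + (b * b' + (c * c' + (a + b + c) * (a' + b' + c'))) =
      (a + b) * (a' + c') + (a + c) * (a' + b') := by
  have h2 : (2 : ZMod 2) = 0 := by decide
  linear_combination (b * b' + c * c') * h2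

/-- **RANK LEMMA**: a set `a` of at most four points, of even size and zero point-sum, has moment
matrix `Σ_{v ∈ a} v vᵀ` of rank `≤ 2` — `a` is empty or a zero-sum quadruple `{p, q, r, p + q + r}`,
whose moment matrix is `x yᵀ + y xᵀ` (`x = p + q`, `y = p + r`). -/
theorem rank_momMat_le_two (a : Finset (Fin m → Bool)) (h4 : a.card ≤ 4) (heven : Even a.card)
    (hσ : ∀ i, ∑ v ∈ a, bvec v i = 0) :
    (∑ v ∈ a, Matrix.vecMulVec (bvec v) (bvec v)).rank ≤ 2 := by
  by_cases h3 : a.card ≤ 3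
  · rw [eq_empty_of_card_le_three a h3 heven hσ, Finset.sum_empty, Matrix.rank_zero]
    exact Nat.zero_le _
  · have hc : a.card = 4 := by omega
    obtain ⟨p, t, hpt, rfl, ht⟩ := Finset.card_eq_succ.1 hc
    obtain ⟨q, r, s, hqr, hqs, hrs, rfl⟩ := Finset.card_eq_three.1 ht
    -- the point-sum relation `s = p + q + r`
    have hs : ∀ i, bvec s i = bvec p i + bvec q i + bvec r i := by
      intro i
      have h := hσ i
      rw [Finset.sum_insert hpt, Finset.sum_insert (by simp [hqr, hqs]), Finset.sum_pair hrs] at h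
      have h' : bvec s i + (bvec p i + bvec q i + bvec r i) = 0 := by
        rw [← h]; ring
      exact (add_eq_zero_iff_eq' _ _).1 h'
    -- the factorisation `Σ v vᵀ = M N`, `M = [x y]`, `N = [y; x]`
    set x : Fin m → ZMod 2 := fun i => bvec p i + bvec q i with hx
    set y : Fin m → ZMod 2 := fun i => bvec p i + bvec r i with hy
    set M : Matrix (Fin m) (Fin 2) (ZMod 2) := Matrix.of fun i k => if k = 0 then x i else y i with hM
    set N : Matrix (Fin 2) (Fin m) (ZMod 2) := Matrix.of fun k j => if k = 0 then y j else x j with hN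
    have hfac : ∑ v ∈ insert p ({q, r, s} : Finset (Fin m → Bool)), Matrix.vecMulVec (bvec v) (bvec v) =
        M * N := by
      rw [Finset.sum_insert hpt, Finset.sum_insert (by simp [hqr, hqs]), Finset.sum_pair hrs]
      ext i j
      simp only [Matrix.add_apply, Matrix.vecMulVec_apply, Matrix.mul_apply, Fin.sum_univ_two, hM, hN,
        Matrix.of_apply, if_true, show (1 : Fin 2) ≠ 0 from by decide, if_false,
        hx, hy, hs]
      exact quad_entry _ _ _ _ _ _
    rw [hfac]
    exact (Matrix.rank_mul_le_left M N).trans (Matrix.rank_le_width M)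

/-! ### Meshulam's bound for a space of rank-`≤ 2` moment matrices -/

/-- A syndrome with zero parity, vanishing beyond order `2`, and zero moment matrix is zero. -/
theorem eq_zero_of_momMat_eq_zero {s : Finset (Fin m) → ZMod 2} (h0 : s ∅ = 0)
    (hbig : ∀ J : Finset (Fin m), ¬ J.card ≤ 2 → s J = 0) (hM : momMat s = 0) : s = 0 := by
  funext J
  rw [Pi.zero_apply]
  by_cases hJ : J.card ≤ 2
  · have hc : J.card = 0 ∨ J.card = 1 ∨ J.card = 2 := by omega
    rcases hc with hc | hc | hc
    · rw [Finset.card_eq_zero.1 hc]; exact h0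
    · obtain ⟨i, rfl⟩ := Finset.card_eq_one.1 hc
      have h := congrFun (congrFun hM i) i
      rw [momMat_apply, Finset.insert_eq_of_mem (Finset.mem_singleton_self _)] at h
      exact h
    · obtain ⟨i, j, _, rfl⟩ := Finset.card_eq_two.1 hc
      have h := congrFun (congrFun hM i) j
      rw [momMat_apply] at h
      exact h
  · exact hbig J hJ

/-- **Meshulam's bound**: a linear space `K` of syndromes with zero parity, vanishing beyond order
`2`, all of whose moment matrices have rank `≤ 2`, has `dim K ≤ 2m` (the moment matrix embeds `K`
into a space of `m × m` matrices of rank `≤ 2`; Meshulam 1985 Thm 2). [cite: Meshulam1985, Thm 2] -/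
theorem finrank_le_two_mul (K : Submodule (ZMod 2) (Finset (Fin m) → ZMod 2))
    (h0 : ∀ s ∈ K, s ∅ = 0) (hbig : ∀ s ∈ K, ∀ J : Finset (Fin m), ¬ J.card ≤ 2 → s J = 0)
    (hrank : ∀ s ∈ K, (momMat s).rank ≤ 2) : finrank (ZMod 2) K ≤ 2 * m := by
  set f : K →ₗ[ZMod 2] Matrix (Fin m) (Fin m) (ZMod 2) := momMat.domRestrict K with hf
  have hinj : Function.Injective f := by
    rw [← LinearMap.ker_eq_bot, Submodule.eq_bot_iff]
    intro s hs
    rw [LinearMap.mem_ker] at hs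
    have h : (s : Finset (Fin m) → ZMod 2) = 0 :=
      eq_zero_of_momMat_eq_zero (h0 s s.2) (hbig s s.2) hs
    exact Subtype.ext h
  rw [← LinearMap.finrank_range_of_inj hinj]
  refine Literature.LinearAlgebra.finrank_le_mul_of_forall_rank_le
    (Literature.LinearAlgebra.Meshulam1985_exists_rank_gt_holds (ZMod 2)) (LinearMap.range f)
    fun A hA => ?_
  obtain ⟨s, rfl⟩ := LinearMap.mem_range.1 hA
  exact hrank s s.2

end Syndrome2

end Summit.QuantumAdvantage.AdviceFreeQNC0

end
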